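/-
Copyright (c) 2026 the pub-hodgecm-mathlib formalisation cell (harness21).  Prover seat hodgecm-mathlib-K2E5-p17 (g6), HCML Track B «K2-LIT» ∕ h413
(`stmt-HodgeConjecture-24833`), line «SC′-IRR-lev» (leaf (S-C′-irr) `sig_K2E3GL3TwoBlockInducedIrreducible`; lead K2E3-p24 (g2), dealer K2E3-plan (g4)),
brick JM-B file 2a: preparations for the closed `P₍₂,₁₎`-orbit — kernel tools, an `Ad(M' ∩ GL₃(𝒪))`-stable compact open subgroup of `N'`, `Z = P · (M' ∩ GL₃(𝒪))`.  2026-09-04.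
-/
import Summits.HodgeConjecture.HodgeConjecture.Theorems.K2E3GL3MaximalParabolicRelabel   -- ★ K0 p859354 (K2E3-p24 (g2)): `c₀ = ![0,0,1]` relabelling, entry criteria, root groups
import Summits.HodgeConjecture.HodgeConjecture.Theorems.K2E3OpenCellJacquetClasses       -- ★ JM-B file 1 p859403 (this seat): open-cell classes (brings the ★ open-cell kit)
import Literature.NumberTheory.Automorphic.IntertwiningMapCharacterCoinvariants          -- ★ `sub_avgProj_mem_coinvariantsKer`, `avgProj_eq_zero_of_mem_coinvariantsKer` (brings ★ `CompactOpenAveraging`)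
import Literature.NumberTheory.Automorphic.ReductiveGroupData                            -- ★ `glInt`, `isCompact_glInt`
import Literature.NumberTheory.Automorphic.GLnStandardLeviUnimodular                     -- ★ `isClosed_standardLeviGL` (brings ★ `mem_standardLeviGL_iff`)
import HarnessLib

/-!
# K2_E3 road (h413), line «SC′-IRR-lev», brick JM-B (file 2a, preparations) — tools for the closed `P₍₂,₁₎`-orbit `Z = {g | g₂₀ = 0} ⊂ GL₃(F)`

Cell `pub/hodgecm-mathlib` (D-0151), Track B, seat K2E5-p17 (g6) (hand JM-B of line «SC′-IRR-lev», lead K2E3-p24 (g2) FILE PLAN v2 10:20:22Z + SPEC 10:27:03Z).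
`--supports stmt-HodgeConjecture-24833 --as helper`; THEOREMS ONLY (no definition ∕ instance ∕ notation ∕ named fact ∕ `sorry`); never imports `Cruxes/…/Lines`.  COUNT-NEUTRAL.

THE MATHEMATICS ([BernsteinZelevinsky1977, §1.8–1.9, Geometrical Lemma 2.12 — the closed orbit of the pair `(P₍₂,₁₎, P₍₁,₂₎)`]; [BernsteinZelevinsky1976, §2.3, §2.33];
[Casselman1995, §2.1]).  `F` a non-archimedean local field, `c₀ = ![0,0,1]`, `P = standardParabolicGL F c₀ = P₍₂,₁₎`, `N' = oppositeCellRadical c₀ = U_{P₍₁,₂₎}`,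
`P' = standardParabolicGL F (toDual ∘ revLabel c₀) = P₍₁,₂₎`, `M' ∩ GL₃(𝒪) = glInt 3 F ⊓ standardLeviGL F ![0,1,1]` (a compact group normalising `N'`).  This file collects the four
inputs of the closed-orbit computation of file 2b (`K2E3GL3CuspidalBlockClosedCell`: «`[f] = [e_B f]` with `e_B f` vanishing on `Z`»):

* §1 generic kernel and transversal tools: `coinvariantsKer_comp_subtype_mono` (`V(B) ⊆ V(B')` for `B ≤ B'`), `coinvariantsKer_comp_subtype_le`, **`exists_compactOpen_mem_coinvariantsKer`**
  (if `Γ` is the union of its compact open subgroups, every `w ∈ V(Γ)` lies in `V(K)` for ONE compact open `K`), `isLeftTransversal_image_mulEquiv` (transport of a finite left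
  transversal along a group automorphism).
* §2 **`exists_subgroup_radicalConj_stable`** — above any compact open `K ≤ N'` there is a compact open subgroup `B` with `m B m⁻¹ = B` for all `m ∈ M' ∩ GL₃(𝒪)`: `B = ⟨C⟩` for the
  saturation `C = ⋃_m m K m⁻¹` (compact, the continuous image of `(M' ∩ GL₃(𝒪)) × K`); `B` is open (`≥ K`) and compact (an open hence closed subgroup of a compact open subgroup
  `L ⊇ C`, ★ `isLimitOfCompactOpen_unipotentRadicalGL`), and `m B m⁻¹ = ⟨m C m⁻¹⟩ = ⟨C⟩`.
* §3 **`exists_eq_parabolic_mul_of_apply_two_zero_eq_zero`** — `Z = {g₂₀ = 0} = P · (M' ∩ GL₃(𝒪))`, with EXPLICIT representatives: `m₀ = x₂₁(z₂₁ ∕ z₂₂)` if `|z₂₁| ≤ |z₂₂|`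
  (`exists_eq_parabolic_mul_of_valuation_le`), and otherwise the same after the column operation `z ↦ z x₁₂(1)` (which makes `|z₂₂ + z₂₁| = |z₂₁|`); no Iwasawa decomposition is invoked.
* §4 `exists_finite_forall_toFun_eq` — a smooth induced vector takes finitely many values on a compact set (finitely many cosets of its open stabiliser cover it).

HONEST LABEL: HC_CM is proved only modulo the 7 printed citations (2 remaining named inputs: hLiu418 = stmt-HodgeConjecture-24832, h413 = stmt-HodgeConjecture-24833) until rung 0
closes; count-neutral helper (kernel lane).

## Mathlib ∕ tree search
★ K0 (`mem_standardParabolicGL_iff_entry`, `mem_oppositeCellRadical_iff_entry`, `reversedParabolic_eq_oneTwo`, `monotone_twoOne`), ★ `OpenCellSections` (`radicalConj`, `coe_radicalConj`,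
`mul_mul_inv_mem_oppositeCellRadical_of_mem`), ★ `CompactOpenAveraging` (`IsLeftTransversal`), ★ `ReductiveGroupData` (`glInt`, `isCompact_glInt`), ★ `WhittakerSupportFinite`
(`transvectionUnit`, `map_transvectionUnit`, `transvectionUnit_inv`), ★ `GLnStandardLeviUnimodular` (`isClosed_standardLeviGL`, `mem_standardLeviGL_iff`), ★ `UnipotentRadicalCompactOpenProofs`
(`isLimitOfCompactOpen_unipotentRadicalGL`), Mathlib `Subgroup.closure`, `MonoidHom.map_closure`, `Subgroup.isOpen_mono`, `Subgroup.isClosed_of_isOpen`, `IsCompact.elim_finite_subcover_image`,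
`Matrix.mul_single_apply_same`, `Valuation.map_add_eq_of_lt_left`, `Matrix.GeneralLinearGroup.det_ne_zero`.  Dedup: `rg "CuspidalBlockClosedCell"` — none.

## References
* [BernsteinZelevinsky1977] I. N. Bernstein, A. V. Zelevinsky, *Induced representations of reductive 𝔭-adic groups I*, Ann. Sci. ÉNS 10 (1977), §1.8–1.9, Lemma 2.12.
* [BernsteinZelevinsky1976] I. N. Bernstein, A. V. Zelevinsky, *Representations of the group GL(n, F) where F is a non-archimedean local field*, Russian Math. Surveys 31:3
  (1976), §2.3, §2.33.
* [Casselman1995] W. Casselman, *Introduction to the theory of admissible representations of 𝔭-adic reductive groups* (draft 1995), §2.1.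
-/

set_option autoImplicit false
set_option linter.dupNamespace false   -- `Summit.HodgeConjecture.HodgeConjecture.…` (D-0017 nested layout; lakefile exemption for Summits)

noncomputable section

open scoped BigOperators Pointwise ValuativeRel
open Matrix OrderDual Topology ValuativeRel
open Literature.NumberTheory.Automorphic
open Summit.HodgeConjecture.HodgeConjecture.Cruxes.H413.K2E3GL3MaximalParabolicRelabel

namespace Summit.HodgeConjecture.HodgeConjecture.Cruxes.H413.K2E3GL3CuspidalBlockClosedCellPrep

/-! ## §1  Generic kernel and transversal tools -/

section KernelTools

variable {k Γ V : Type*} [CommRing k] [Group Γ] [AddCommGroup V] [Module k V] (ρ : Representation k Γ V)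

/-- The coinvariant kernel of a restriction grows with the subgroup: `V(B) ⊆ V(B')` for `B ≤ B'`. [cite: BernsteinZelevinsky1977, §1.8] -/
theorem coinvariantsKer_comp_subtype_mono {B B' : Subgroup Γ} (h : B ≤ B') :
    Representation.Coinvariants.ker (ρ.comp B.subtype) ≤ Representation.Coinvariants.ker (ρ.comp B'.subtype) := by
  refine Submodule.span_le.2 ?_
  rintro _ ⟨⟨b, v⟩, rfl⟩
  exact Representation.Coinvariants.mem_ker_of_eq (ρ := ρ.comp B'.subtype) ⟨(b : Γ), h b.2⟩ v _ rfl

/-- `V(B) ⊆ V(Γ)` for a subgroup `B ≤ Γ`. [cite: BernsteinZelevinsky1977, §1.8] -/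
theorem coinvariantsKer_comp_subtype_le (B : Subgroup Γ) :
    Representation.Coinvariants.ker (ρ.comp B.subtype) ≤ Representation.Coinvariants.ker ρ := by
  refine Submodule.span_le.2 ?_
  rintro _ ⟨⟨b, v⟩, rfl⟩
  exact Representation.Coinvariants.mem_ker_of_eq (ρ := ρ) (b : Γ) v _ rfl

/-- **One compact open subgroup suffices**: if `Γ` is the union of its compact open subgroups, every `w ∈ V(Γ)` already lies in `V(K)` for some compact open subgroup `K ≤ Γ`
(the finitely many group elements of a presentation of `w` lie in one such `K`). [cite: BernsteinZelevinsky1976, §2.33] -/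
theorem exists_compactOpen_mem_coinvariantsKer [TopologicalSpace Γ] (hΓ : IsLimitOfCompactOpen Γ)
    {w : V} (hw : w ∈ Representation.Coinvariants.ker ρ) :
    ∃ K : Subgroup Γ, IsOpen (K : Set Γ) ∧ IsCompact (K : Set Γ) ∧ w ∈ Representation.Coinvariants.ker (ρ.comp K.subtype) := by
  induction hw using Submodule.span_induction with
  | mem x hx =>
    obtain ⟨⟨g, v⟩, rfl⟩ := hx
    obtain ⟨K, hKo, hKc, hgK⟩ := hΓ {g} isCompact_singleton
    exact ⟨K, hKo, hKc, Representation.Coinvariants.mem_ker_of_eq (ρ := ρ.comp K.subtype) ⟨g, hgK (Set.mem_singleton g)⟩ v _ rfl⟩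
  | zero =>
    obtain ⟨K, hKo, hKc, -⟩ := hΓ ∅ isCompact_empty
    exact ⟨K, hKo, hKc, Submodule.zero_mem _⟩
  | add x y _ _ hx hy =>
    obtain ⟨K₁, _, hK₁c, hx⟩ := hx
    obtain ⟨K₂, _, hK₂c, hy⟩ := hy
    obtain ⟨K, hKo, hKc, hsub⟩ := hΓ _ (hK₁c.union hK₂c)
    exact ⟨K, hKo, hKc, Submodule.add_mem _
      (coinvariantsKer_comp_subtype_mono ρ (fun g hg => hsub (Or.inl hg)) hx)
      (coinvariantsKer_comp_subtype_mono ρ (fun g hg => hsub (Or.inr hg)) hy)⟩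
  | smul a x _ hx =>
    obtain ⟨K, hKo, hKc, hx⟩ := hx
    exact ⟨K, hKo, hKc, Submodule.smul_mem _ a hx⟩

omit [AddCommGroup V] [Module k V] in
/-- **Transport of a finite left transversal along a group automorphism** `e`: `e(R)` is a left transversal of `e(B)` modulo `e(S)` (written with `comap e.symm`). [cite: BernsteinZelevinsky1976, §2.3] -/
theorem isLeftTransversal_image_mulEquiv [DecidableEq Γ] {B S : Subgroup Γ} {R : Finset Γ}
    (h : IsLeftTransversal B S R) (e : Γ ≃* Γ) :
    IsLeftTransversal (B.comap e.symm.toMonoidHom) (S.comap e.symm.toMonoidHom) (R.image e) := by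
  refine ⟨fun y hy => ?_, fun y hy => ?_⟩
  · obtain ⟨r, hr, rfl⟩ := Finset.mem_image.1 hy
    rw [Subgroup.mem_comap, MulEquiv.coe_toMonoidHom, e.symm_apply_apply]
    exact h.mem_of_mem r hr
  · have hx : e.symm y ∈ B := by simpa only [Subgroup.mem_comap, MulEquiv.coe_toMonoidHom] using hy
    obtain ⟨r, ⟨hrR, hrx⟩, huniq⟩ := h.existsUnique (e.symm y) hx
    refine ⟨e r, ⟨Finset.mem_image.2 ⟨r, hrR, rfl⟩, ?_⟩, ?_⟩
    · rw [Subgroup.mem_comap, MulEquiv.coe_toMonoidHom, map_mul, map_inv, e.symm_apply_apply]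
      exact hrx
    · rintro r' ⟨hr'R, hr'y⟩
      obtain ⟨r₀, hr₀R, rfl⟩ := Finset.mem_image.1 hr'R
      rw [Subgroup.mem_comap, MulEquiv.coe_toMonoidHom, map_mul, map_inv, e.symm_apply_apply] at hr'y
      rw [huniq r₀ ⟨hr₀R, hr'y⟩]

end KernelTools

/-! ## The `GL₃` frame -/

variable {F : Type*} [Field F] [ValuativeRel F] [TopologicalSpace F] [IsNonarchimedeanLocalField F]

section Frame

omit [ValuativeRel F] [TopologicalSpace F] [IsNonarchimedeanLocalField F] in
/-- `N' = U_{P₍₁,₂₎} ≤ P = P₍₂,₁₎` (the first row acts inside the `GL₂` block and by the root group `(0,2) ⊂ U_P`). [cite: BernsteinZelevinsky1977, §2.1] -/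
theorem oppositeCellRadical_le_standardParabolicGL :
    oppositeCellRadical (K := F) (![0, 0, 1] : Fin 3 → Fin 2) ≤ standardParabolicGL F (![0, 0, 1] : Fin 3 → Fin 2) := by
  intro g hg
  rw [mem_oppositeCellRadical_iff_entry] at hg
  rw [mem_standardParabolicGL_iff_entry, hg 2 0 (by decide), hg 2 1 (by decide)]
  simp

omit [TopologicalSpace F] [IsNonarchimedeanLocalField F] in
/-- `M' ∩ GL₃(𝒪) ≤ P'` (block diagonal matrices for `{0} < {1,2}` are block triangular). [cite: BernsteinZelevinsky1977, §2.1] -/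
theorem inf_standardLeviGL_le_reversedParabolic :
    glInt 3 F ⊓ standardLeviGL F (![0, 1, 1] : Fin 3 → Fin 2) ≤ standardParabolicGL F (⇑toDual ∘ revLabel (![0, 0, 1] : Fin 3 → Fin 2)) := by
  rw [reversedParabolic_eq_oneTwo]
  exact fun g hg => standardLeviGL_le F _ hg.2

end Frame

/-! ## §2  A compact open subgroup of `N'` normalised by `M' ∩ GL₃(𝒪)` -/

section Stable

/-- **A compact open `B ≤ N'`, above a given compact open `K`, NORMALISED BY `M' ∩ GL₃(𝒪)`.**  Take the `M' ∩ GL₃(𝒪)`-saturation `C = ⋃_m m K m⁻¹` of `K` (compact: the continuous image of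
`(M' ∩ GL₃(𝒪)) × K`) and `B = ⟨C⟩`: open since `B ≥ K`; compact since `C` lies in SOME compact open subgroup `L` of `N'` (★ `isLimitOfCompactOpen_unipotentRadicalGL`), so `B ≤ L` is an open,
hence closed, subgroup of the compact `L`; and `m B m⁻¹ = ⟨m C m⁻¹⟩ = ⟨C⟩ = B`. [cite: BernsteinZelevinsky1976, §2.3] [cite: Casselman1995, §2.1] -/
theorem exists_subgroup_radicalConj_stable
    (K : Subgroup ↥(oppositeCellRadical (K := F) (![0, 0, 1] : Fin 3 → Fin 2)))
    (hKo : IsOpen (K : Set ↥(oppositeCellRadical (K := F) (![0, 0, 1] : Fin 3 → Fin 2))))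
    (hKc : IsCompact (K : Set ↥(oppositeCellRadical (K := F) (![0, 0, 1] : Fin 3 → Fin 2)))) :
    ∃ B : Subgroup ↥(oppositeCellRadical (K := F) (![0, 0, 1] : Fin 3 → Fin 2)),
      IsOpen (B : Set ↥(oppositeCellRadical (K := F) (![0, 0, 1] : Fin 3 → Fin 2))) ∧
      IsCompact (B : Set ↥(oppositeCellRadical (K := F) (![0, 0, 1] : Fin 3 → Fin 2))) ∧ K ≤ B ∧
      ∀ {m : GL (Fin 3) F} (hm : m ∈ glInt 3 F ⊓ standardLeviGL F (![0, 1, 1] : Fin 3 → Fin 2))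
        (x : ↥(oppositeCellRadical (K := F) (![0, 0, 1] : Fin 3 → Fin 2))),
        radicalConj (inf_standardLeviGL_le_reversedParabolic hm) x ∈ B ↔ x ∈ B := by
  haveI : T2Space F := (Literature.NumberTheory.GaloisRepresentations.IsNonarchimedeanLocalField.isLocalField F).toT2Space
  -- `M' ∩ GL₃(𝒪)` and `K` are compact spaces
  have hH₀c : IsCompact ((glInt 3 F ⊓ standardLeviGL F (![0, 1, 1] : Fin 3 → Fin 2) : Subgroup (GL (Fin 3) F)) : Set (GL (Fin 3) F)) := by
    rw [Subgroup.coe_inf]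
    exact (isCompact_glInt 3 F).inter_right (isClosed_standardLeviGL (R := F) (![0, 1, 1] : Fin 3 → Fin 2))
  haveI : CompactSpace ↥(glInt 3 F ⊓ standardLeviGL F (![0, 1, 1] : Fin 3 → Fin 2)) := isCompact_iff_compactSpace.1 hH₀c
  haveI : CompactSpace ↥K := isCompact_iff_compactSpace.1 hKc
  -- the saturation `C = ⋃_m m K m⁻¹` as the range of a continuous map
  let φ : ↥(glInt 3 F ⊓ standardLeviGL F (![0, 1, 1] : Fin 3 → Fin 2)) × ↥K →
      ↥(oppositeCellRadical (K := F) (![0, 0, 1] : Fin 3 → Fin 2)) := fun p =>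
    ⟨(p.1 : GL (Fin 3) F) * ((p.2 : ↥(oppositeCellRadical (K := F) (![0, 0, 1] : Fin 3 → Fin 2))) : GL (Fin 3) F) * (p.1 : GL (Fin 3) F)⁻¹,
      mul_mul_inv_mem_oppositeCellRadical_of_mem (inf_standardLeviGL_le_reversedParabolic p.1.2)
        (p.2 : ↥(oppositeCellRadical (K := F) (![0, 0, 1] : Fin 3 → Fin 2))).2⟩
  have hφ : Continuous φ := by
    apply Continuous.subtype_mk
    exact ((continuous_subtype_val.comp continuous_fst).mul
      (continuous_subtype_val.comp (continuous_subtype_val.comp continuous_snd))).mul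
      ((continuous_subtype_val.comp continuous_fst).inv)
  have hφ_eq : ∀ (m : ↥(glInt 3 F ⊓ standardLeviGL F (![0, 1, 1] : Fin 3 → Fin 2))) (x : ↥K),
      φ (m, x) = radicalConj (inf_standardLeviGL_le_reversedParabolic m.2) (x : ↥(oppositeCellRadical (K := F) (![0, 0, 1] : Fin 3 → Fin 2))) :=
    fun m x => Subtype.ext rfl
  obtain ⟨C, hC⟩ : ∃ C : Set ↥(oppositeCellRadical (K := F) (![0, 0, 1] : Fin 3 → Fin 2)), C = Set.range φ := ⟨_, rfl⟩
  have hCc : IsCompact C := by rw [hC]; exact isCompact_range hφ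
  -- a compact open subgroup `L ⊇ C`
  have hlim : IsLimitOfCompactOpen ↥(oppositeCellRadical (K := F) (![0, 0, 1] : Fin 3 → Fin 2)) :=
    isLimitOfCompactOpen_unipotentRadicalGL F (⇑toDual ∘ revLabel (![0, 0, 1] : Fin 3 → Fin 2)) (monotone_toDual_revLabel _ monotone_twoOne)
  obtain ⟨L, hLo, hLc, hCL⟩ := hlim C hCc
  -- `B = ⟨C⟩`
  refine ⟨Subgroup.closure C, ?_, ?_, ?_, ?_⟩
  · -- open: contains `K`
    refine Subgroup.isOpen_mono (H₁ := K) (fun x hx => Subgroup.subset_closure ?_) hKo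
    rw [hC]
    exact ⟨(1, ⟨x, hx⟩), Subtype.ext (by simp [φ])⟩
  · -- compact: a closed subgroup of the compact `L`
    have hle : Subgroup.closure C ≤ L := (Subgroup.closure_le L).2 hCL
    have hKB : K ≤ Subgroup.closure C := fun x hx => Subgroup.subset_closure (by rw [hC]; exact ⟨(1, ⟨x, hx⟩), Subtype.ext (by simp [φ])⟩)
    exact hLc.of_isClosed_subset (Subgroup.isClosed_of_isOpen _ (Subgroup.isOpen_mono hKB hKo)) hle
  · exact fun x hx => Subgroup.subset_closure (by rw [hC]; exact ⟨(1, ⟨x, hx⟩), Subtype.ext (by simp [φ])⟩)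
  · intro m hm x
    -- `e_m '' C = C`
    have himage : (radicalConj (inf_standardLeviGL_le_reversedParabolic hm)) '' C = C := by
      apply Set.Subset.antisymm
      · rintro _ ⟨y, hy, rfl⟩
        rw [hC] at hy ⊢
        obtain ⟨⟨m', x'⟩, rfl⟩ := hy
        refine ⟨(⟨m, hm⟩ * m', x'), Subtype.ext ?_⟩
        simp only [φ, hφ_eq, coe_radicalConj, Subgroup.coe_mul]
        group
      · intro y hy
        rw [hC] at hy
        obtain ⟨⟨m', x'⟩, rfl⟩ := hy
        refine ⟨φ ((⟨m, hm⟩ : ↥(glInt 3 F ⊓ standardLeviGL F (![0, 1, 1] : Fin 3 → Fin 2)))⁻¹ * m', x'), ?_, Subtype.ext ?_⟩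
        · rw [hC]; exact ⟨_, rfl⟩
        · simp only [φ, coe_radicalConj, Subgroup.coe_mul, Subgroup.coe_inv]
          group
    have hmap : (Subgroup.closure C).map (radicalConj (inf_standardLeviGL_le_reversedParabolic hm)).toMonoidHom = Subgroup.closure C := by
      rw [MonoidHom.map_closure, MulEquiv.coe_toMonoidHom, himage]
    constructor
    · intro h
      rw [← hmap] at h
      obtain ⟨y, hy, hyx⟩ := Subgroup.mem_map.1 h
      rw [MulEquiv.coe_toMonoidHom] at hyx
      rwa [← (radicalConj (inf_standardLeviGL_le_reversedParabolic hm)).injective hyx]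
    · intro h
      rw [← hmap]
      exact Subgroup.mem_map_of_mem _ h

end Stable

/-! ## §3  The closed orbit `Z = {g₂₀ = 0}` is `P · (M' ∩ GL₃(𝒪))` -/

section Representatives

omit [TopologicalSpace F] [IsNonarchimedeanLocalField F] in
/-- `x₂₁(t) ∈ M' ∩ GL₃(𝒪)` for `t ∈ 𝒪`. [cite: BernsteinZelevinsky1977, §2.1] -/
theorem transvectionUnit_two_one_mem_inf {t : F} (ht : t ∈ 𝒪[F]) :
    (transvectionUnit 2 1 (by decide) t : GL (Fin 3) F) ∈ glInt 3 F ⊓ standardLeviGL F (![0, 1, 1] : Fin 3 → Fin 2) := by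
  have hL : (transvectionUnit 2 1 (by decide) t : GL (Fin 3) F) ∈ standardLeviGL F (![0, 1, 1] : Fin 3 → Fin 2) := by
    refine (mem_standardLeviGL_iff (![0, 1, 1] : Fin 3 → Fin 2) _).2 fun i j hij => ?_
    rw [coe_transvectionUnit, Matrix.add_apply, Matrix.single_apply]
    fin_cases i <;> fin_cases j <;> first | exact absurd rfl hij | simp
  exact Subgroup.mem_inf.2 ⟨⟨transvectionUnit 2 1 (by decide) (⟨t, ht⟩ : 𝒪[F]), map_transvectionUnit _ _ _ _ _⟩, hL⟩

omit [TopologicalSpace F] [IsNonarchimedeanLocalField F] in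
/-- `x₁₂(t) ∈ M' ∩ GL₃(𝒪)` for `t ∈ 𝒪`. [cite: BernsteinZelevinsky1977, §2.1] -/
theorem transvectionUnit_one_two_mem_inf {t : F} (ht : t ∈ 𝒪[F]) :
    (transvectionUnit 1 2 (by decide) t : GL (Fin 3) F) ∈ glInt 3 F ⊓ standardLeviGL F (![0, 1, 1] : Fin 3 → Fin 2) := by
  have hL : (transvectionUnit 1 2 (by decide) t : GL (Fin 3) F) ∈ standardLeviGL F (![0, 1, 1] : Fin 3 → Fin 2) := by
    refine (mem_standardLeviGL_iff (![0, 1, 1] : Fin 3 → Fin 2) _).2 fun i j hij => ?_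
    rw [coe_transvectionUnit, Matrix.add_apply, Matrix.single_apply]
    fin_cases i <;> fin_cases j <;> first | exact absurd rfl hij | simp
  exact Subgroup.mem_inf.2 ⟨⟨transvectionUnit 1 2 (by decide) (⟨t, ht⟩ : 𝒪[F]), map_transvectionUnit _ _ _ _ _⟩, hL⟩

omit [ValuativeRel F] [TopologicalSpace F] [IsNonarchimedeanLocalField F] in
/-- Entries of a right translate by an elementary unipotent: `(z · x_{ij}(c))_{ab} = z_{ab} + [b = j] z_{ai} c`. [cite: BernsteinZelevinsky1977, §2.1] -/
theorem mul_transvectionUnit_apply (z : GL (Fin 3) F) {i j : Fin 3} (hij : i ≠ j) (c : F) (a b : Fin 3) :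
    ((z * transvectionUnit i j hij c : GL (Fin 3) F) : Matrix (Fin 3) (Fin 3) F) a b =
      (z : Matrix (Fin 3) (Fin 3) F) a b + if b = j then (z : Matrix (Fin 3) (Fin 3) F) a i * c else 0 := by
  rw [Units.val_mul, coe_transvectionUnit, Matrix.mul_add, Matrix.mul_one, Matrix.add_apply]
  congr 1
  by_cases hb : b = j
  · subst hb
    simp
  · simp [hb]

omit [ValuativeRel F] [TopologicalSpace F] [IsNonarchimedeanLocalField F] in
/-- **The last row of an invertible matrix with `z₂₀ = 0` has `(z₂₁, z₂₂) ≠ 0`.** [cite: BernsteinZelevinsky1977, §2.1] -/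
theorem apply_two_ne_zero_of_apply_two_zero_eq_zero (z : GL (Fin 3) F) (hz : (z : Matrix (Fin 3) (Fin 3) F) 2 0 = 0)
    (h21 : (z : Matrix (Fin 3) (Fin 3) F) 2 1 = 0) : (z : Matrix (Fin 3) (Fin 3) F) 2 2 ≠ 0 := by
  intro h22
  apply Matrix.GeneralLinearGroup.det_ne_zero z
  refine Matrix.det_eq_zero_of_row_eq_zero 2 fun j => ?_
  fin_cases j
  · exact hz
  · exact h21
  · exact h22

omit [TopologicalSpace F] [IsNonarchimedeanLocalField F] in
/-- **Case `|z₂₁| ≤ |z₂₂|`**: `z = p · x₂₁(z₂₁ ∕ z₂₂)` with `p ∈ P`. [cite: BernsteinZelevinsky1977, Lemma 2.12] -/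
theorem exists_eq_parabolic_mul_of_valuation_le (z : GL (Fin 3) F) (hz : (z : Matrix (Fin 3) (Fin 3) F) 2 0 = 0)
    (hle : valuation F ((z : Matrix (Fin 3) (Fin 3) F) 2 1) ≤ valuation F ((z : Matrix (Fin 3) (Fin 3) F) 2 2)) :
    ∃ p ∈ standardParabolicGL F (![0, 0, 1] : Fin 3 → Fin 2), ∃ m₀ ∈ glInt 3 F ⊓ standardLeviGL F (![0, 1, 1] : Fin 3 → Fin 2), z = p * m₀ := by
  have h22 : (z : Matrix (Fin 3) (Fin 3) F) 2 2 ≠ 0 := by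
    intro h22
    rw [h22, map_zero, le_zero_iff, map_eq_zero] at hle
    exact apply_two_ne_zero_of_apply_two_zero_eq_zero z hz hle h22
  set t : F := (z : Matrix (Fin 3) (Fin 3) F) 2 1 / (z : Matrix (Fin 3) (Fin 3) F) 2 2 with ht_def
  have ht : t ∈ 𝒪[F] := by
    rw [Valuation.mem_integer_iff, ht_def, map_div₀]
    exact div_le_one_of_le₀ hle zero_le
  refine ⟨z * (transvectionUnit 2 1 (by decide) t)⁻¹, ?_, transvectionUnit 2 1 (by decide) t, transvectionUnit_two_one_mem_inf ht,
    (inv_mul_cancel_right z _).symm⟩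
  rw [transvectionUnit_inv, mem_standardParabolicGL_iff_entry, mul_transvectionUnit_apply, mul_transvectionUnit_apply, hz]
  refine ⟨by simp, ?_⟩
  rw [if_pos rfl, ht_def]
  field_simp
  ring

omit [TopologicalSpace F] [IsNonarchimedeanLocalField F] in
/-- **`Z = {g₂₀ = 0} = P · (M' ∩ GL₃(𝒪))`**: every `z` with `z₂₀ = 0` is `p · m₀` with `p ∈ P₍₂,₁₎` and `m₀ ∈ GL₃(𝒪)` block diagonal for `{0} < {1,2}` (if `|z₂₂| < |z₂₁|`, first apply the
column operation `z ↦ z x₁₂(1)`, which makes `|z₂₁| ≤ |z₂₂| = |z₂₁ + z₂₂|`). [cite: BernsteinZelevinsky1977, Lemma 2.12] -/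
theorem exists_eq_parabolic_mul_of_apply_two_zero_eq_zero (z : GL (Fin 3) F) (hz : (z : Matrix (Fin 3) (Fin 3) F) 2 0 = 0) :
    ∃ p ∈ standardParabolicGL F (![0, 0, 1] : Fin 3 → Fin 2), ∃ m₀ ∈ glInt 3 F ⊓ standardLeviGL F (![0, 1, 1] : Fin 3 → Fin 2), z = p * m₀ := by
  by_cases hle : valuation F ((z : Matrix (Fin 3) (Fin 3) F) 2 1) ≤ valuation F ((z : Matrix (Fin 3) (Fin 3) F) 2 2)
  · exact exists_eq_parabolic_mul_of_valuation_le z hz hle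
  · rw [not_le] at hle
    set z' : GL (Fin 3) F := z * transvectionUnit 1 2 (by decide) (1 : F) with hz'
    have hz'20 : (z' : Matrix (Fin 3) (Fin 3) F) 2 0 = 0 := by
      rw [hz', mul_transvectionUnit_apply, hz]; simp
    have hz'21 : (z' : Matrix (Fin 3) (Fin 3) F) 2 1 = (z : Matrix (Fin 3) (Fin 3) F) 2 1 := by
      rw [hz', mul_transvectionUnit_apply]; simp
    have hz'22 : (z' : Matrix (Fin 3) (Fin 3) F) 2 2 = (z : Matrix (Fin 3) (Fin 3) F) 2 1 + (z : Matrix (Fin 3) (Fin 3) F) 2 2 := by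
      rw [hz', mul_transvectionUnit_apply, if_pos rfl, mul_one, add_comm]
    have hle' : valuation F ((z' : Matrix (Fin 3) (Fin 3) F) 2 1) ≤ valuation F ((z' : Matrix (Fin 3) (Fin 3) F) 2 2) := by
      rw [hz'21, hz'22, Valuation.map_add_eq_of_lt_left _ hle]
    obtain ⟨p, hp, m₀, hm₀, hpm⟩ := exists_eq_parabolic_mul_of_valuation_le z' hz'20 hle'
    refine ⟨p, hp, m₀ * (transvectionUnit 1 2 (by decide) (1 : F))⁻¹, Subgroup.mul_mem _ hm₀ (Subgroup.inv_mem _ ?_), ?_⟩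
    · exact transvectionUnit_one_two_mem_inf (Subring.one_mem _)
    · rw [← mul_assoc, ← hpm, hz', mul_inv_cancel_right]

end Representatives

/-! ## §4  A smooth induced vector takes finitely many values on a compact set -/

section Values

variable {P : Subgroup (GL (Fin 3) F)} {W : Type*} [AddCommGroup W] [Module ℂ W] {σ' : Representation ℂ ↥P W}

/-- **Finitely many values on a compact set**: for `f ∈ Ind_P^G σ'` (fixed by the open `Stab(f)`) and a compact `C ⊆ G` there is a finite `S ⊆ C` such that every value `f(x)`,
`x ∈ C`, is an `f(y)`, `y ∈ S` (finitely many cosets `y · Stab(f)` cover `C`). [cite: BernsteinZelevinsky1976, §2.22] -/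
theorem exists_finite_forall_toFun_eq (f : Representation.SmoothInd P σ') {C : Set (GL (Fin 3) F)} (hC : IsCompact C) :
    ∃ S : Set (GL (Fin 3) F), S ⊆ C ∧ S.Finite ∧ ∀ x ∈ C, ∃ y ∈ S, f.toFun x = f.toFun y := by
  have hTo : IsOpen (((Representation.smoothIndRep P σ').stabilizerSubgroup f : Subgroup (GL (Fin 3) F)) : Set (GL (Fin 3) F)) :=
    Representation.isSmooth_smoothInd P σ' f
  let U : GL (Fin 3) F → Set (GL (Fin 3) F) := fun y => {x | y⁻¹ * x ∈ (Representation.smoothIndRep P σ').stabilizerSubgroup f}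
  have hUo : ∀ y ∈ C, IsOpen (U y) := fun y _ => hTo.preimage (continuous_const.mul continuous_id)
  have hcover : C ⊆ ⋃ y ∈ C, U y := fun x hx => Set.mem_iUnion₂.2 ⟨x, hx, by simp [U]⟩
  obtain ⟨S, hSC, hSfin, hS⟩ := hC.elim_finite_subcover_image hUo hcover
  refine ⟨S, hSC, hSfin, fun x hx => ?_⟩
  obtain ⟨y, hy, hxy⟩ : ∃ y ∈ S, x ∈ U y := by simpa only [Set.mem_iUnion, exists_prop] using hS hx
  refine ⟨y, hy, ?_⟩
  have hfix : Representation.smoothIndRep P σ' (y⁻¹ * x) f = f := (Representation.mem_stabilizerSubgroup _ _ _).1 hxy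
  have h := congrArg (fun g : Representation.SmoothInd P σ' => g.toFun y) hfix
  simp only [Representation.toFun_smoothIndRep_apply, mul_inv_cancel_left] at h
  exact h

end Values

end Summit.HodgeConjecture.HodgeConjecture.Cruxes.H413.K2E3GL3CuspidalBlockClosedCellPrep

end
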